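import Literature.Geometry.Riemannian.HamiltonSurgeryProgrammeProofs
import Literature.Topology.FourManifolds.SurgeryGlueBallCut
import Literature.Topology.FourManifolds.SurgeryGlueTubeCut
import Literature.Topology.FourManifolds.SurgeryGlueMatched
import HarnessLib

/-!
# Reconstruction data make a manifold neck-surgery resolvable

The inductive heart of the glue from `chenZhu_ricciFlowWithSurgery` to neck-surgery resolvability
(`IsNeckSurgeryResolvable`, `HamiltonSurgeryProgramme.lean`; cf. `SurgicalRicciFlowBridge.lean`)
(R. Hamilton, *Four-manifolds with positive isotropic curvature*, Comm. Anal. Geom. 5 (1997) §1.1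
pp. 3–4; B.-L. Chen, X.-P. Zhu, J. Differential Geom. 74 (2006) Thm. 1.1): if a compact simply
connected 4-manifold `Q` carries a **reconstruction datum** over `M'`
(`Literature.Topology.FourManifolds.SurgeryGlueData`: `Q` minus finitely many tube pieces
`𝕊³ × (0,1)` and ball pieces is identified by `e` with an open part of `M'`, the ends being collared
by surgery balls of `M'`), and every compact open simply connected submanifold-component of `M'` is
neck-surgery resolvable, then `Q` is neck-surgery resolvable
(`isNeckSurgeryResolvable_of_surgeryGlueData`). Proof by induction on the complexity
`3 · #tubes + #balls`: a tube is cut along its middle neck (`SurgeryGlueData.halfCut`, both capped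
sides carry data of smaller complexity); a ball piece is cut along an `M'`-adapted collar neck
(`SurgeryGlueData.ballCut`: the far side carries data of smaller complexity, the near side is a
twisted sphere, hence `𝕊⁴` by Cerf); with matched balls only, `Q` is diffeomorphic to an open and
closed part of `M'` (`SurgeryGlueData.diffeomorphRange`).

## References

* R. S. Hamilton, *Four-manifolds with positive isotropic curvature*, Comm. Anal. Geom. 5 (1997)
  1–92, §1.1 pp. 3–4, Thm. 1.1, Cor. 1.2. [Hamilton1997]
* B.-L. Chen, X.-P. Zhu, *Ricci flow with surgery on four-manifolds with positive isotropic
  curvature*, J. Differential Geom. 74 (2006) 177–264, Thm. 1.1. [ChenZhu2006]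
* J. Cerf, *Sur les difféomorphismes de la sphère de dimension trois (Γ₄ = 0)*, LNM 53 (1968). [Cerf1968]
-/

open scoped Manifold ContDiff Topology
open Set Function Metric Module Filter TopologicalSpace
open Literature.Topology.FourManifolds

noncomputable section

namespace Literature.Geometry.Riemannian

/-- Local notation: `𝔼 n` is the model Euclidean space `EuclideanSpace ℝ (Fin n)`. -/
local notation "𝔼 " n:arg => EuclideanSpace ℝ (Fin n)

attribute [local instance] fact_finrank_euclideanSpace_succ

/-- The hypothesis on the next stage `M'`: its compact, open-and-closed, connected, simply
connected submanifolds (unions of components) are neck-surgery resolvable. [folklore] -/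
def NextStageResolvable (M' : Type) [TopologicalSpace M'] [ChartedSpace (𝔼 4) M'] : Prop :=
  ∀ C : Opens M', IsClosed (C : Set M') → CompactSpace C → ConnectedSpace C → SimplyConnectedSpace C →
    IsNeckSurgeryResolvable C

/-- **Reconstruction data make a compact simply connected manifold neck-surgery resolvable**
(induction on the complexity). [cite: Hamilton1997, §1.1 pp. 3–4] -/
theorem isNeckSurgeryResolvable_of_surgeryGlueData_aux (hC : Literature.Topology.FourManifolds.cerf_twistedSphere_four)
    {M' : Type} [TopologicalSpace M'] [T2Space M'] [ChartedSpace (𝔼 4) M'] [IsManifold (𝓡 4) ∞ M'] (hM' : NextStageResolvable M') :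
    ∀ (μ : ℕ) (Q : Type) [TopologicalSpace Q] [T2Space Q] [CompactSpace Q] [ChartedSpace (𝔼 4) Q] [IsManifold (𝓡 4) ∞ Q]
      [ConnectedSpace Q] [SimplyConnectedSpace Q] (G : SurgeryGlueData (𝔼 4) 3 Q M'), G.complexity = μ → IsNeckSurgeryResolvable Q := by
  intro μ
  induction μ using Nat.strong_induction_on with
  | _ μ ih =>
  intro Q _ _ _ _ _ _ _ G hμ
  by_cases hIt : Nonempty G.P.It
  · -- cut a tube along its middle neck
    obtain ⟨i₀⟩ := hIt
    obtain ⟨D₁, D₂, hdisj, hcover⟩ := G.exists_sides_midNeck i₀ (by norm_num : (3 : ℕ) ≠ 0)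
    have hψ₁ : ∀ (θ : sphere (0 : 𝔼 4) 1) (τ : ℝ), G.midNeck i₀ true (θ, τ) = G.P.tube i₀ (θ, 1 / 2 + SurgeryGlueData.endSign true * τ) := fun _ _ => rfl
    have hψ₂ : ∀ (θ : sphere (0 : 𝔼 4) 1) (τ : ℝ), (fun q : sphere (0 : 𝔼 4) 1 × ℝ => G.midNeck i₀ true (q.1, -q.2)) (θ, τ) =
        G.P.tube i₀ (θ, 1 / 2 + SurgeryGlueData.endSign false * τ) := fun θ τ => by
      change G.midNeck i₀ true (θ, -τ) = _
      rw [G.midNeck_true_neg i₀ θ τ]; rfl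
    haveI := D₁.connectedSpace_capped_left D₂ hdisj hcover
    haveI := D₁.connectedSpace_capped_right D₂ hdisj hcover
    haveI := D₁.simplyConnectedSpace_capped_left D₂ hdisj hcover (by norm_num)
    haveI := D₁.simplyConnectedSpace_capped_right D₂ hdisj hcover (by norm_num)
    have h₁ := ih _ (hμ ▸ G.complexity_halfCut_lt i₀ true hψ₁ D₁ (by norm_num)) D₁.Capped (G.halfCut i₀ true hψ₁ D₁ (by norm_num)) rfl
    have h₂ := ih _ (hμ ▸ G.complexity_halfCut_lt i₀ false hψ₂ D₂ (by norm_num)) D₂.Capped (G.halfCut i₀ false hψ₂ D₂ (by norm_num)) rfl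
    exact .surgery D₁ D₂ hdisj hcover h₁ h₂
  · by_cases hIb : Nonempty G.P.Ib
    · -- cut a ball piece along its `M'`-adapted collar neck
      obtain ⟨j₀⟩ := hIb
      set B := G.collar j₀ with hB
      haveI := B.far.connectedSpace_capped_left B.near B.disjoint_far_near B.cover_far_near
      haveI := B.far.simplyConnectedSpace_capped_left B.near B.disjoint_far_near B.cover_far_near (by norm_num)
      have h₁ := ih _ (by rw [← hμ, ← G.complexity_ballCut j₀]; exact Nat.lt_succ_self _) B.far.Capped (G.ballCut j₀) rfl
      have h₂ : IsNeckSurgeryResolvable B.near.Capped :=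
        .piece (IsHamiltonPICPiece.of_nonempty_diffeomorph_sphere (B.nonempty_diffeomorph_sphere_four hC))
      exact .surgery B.far B.near B.disjoint_far_near B.cover_far_near h₁ h₂
    · -- only matched balls: `Q` is an open and closed part of `M'`
      haveI : IsEmpty G.P.It := not_nonempty_iff.1 hIt
      haveI : IsEmpty G.P.Ib := not_nonempty_iff.1 hIb
      let Φ := G.diffeomorphRange
      haveI : CompactSpace G.rangeOpens := Φ.toHomeomorph.compactSpace
      haveI : ConnectedSpace G.rangeOpens := by
        change ConnectedSpace ↥(range G.glueMap)
        exact isConnected_iff_connectedSpace.1 (isConnected_range G.contMDiff_glueMap.continuous)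
      haveI : SimplyConnectedSpace G.rangeOpens := Φ.toHomeomorph.toHomotopyEquiv.simplyConnectedSpace_iff.1 inferInstance
      exact (hM' G.rangeOpens G.isClosed_range_glueMap inferInstance inferInstance inferInstance).of_diffeomorph Φ.symm

/-- **Reconstruction data make a compact simply connected manifold neck-surgery resolvable.**
[cite: Hamilton1997, §1.1 pp. 3–4] -/
theorem isNeckSurgeryResolvable_of_surgeryGlueData (hC : Literature.Topology.FourManifolds.cerf_twistedSphere_four)
    {M' : Type} [TopologicalSpace M'] [T2Space M'] [ChartedSpace (𝔼 4) M'] [IsManifold (𝓡 4) ∞ M'] (hM' : NextStageResolvable M')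
    {Q : Type} [TopologicalSpace Q] [T2Space Q] [CompactSpace Q] [ChartedSpace (𝔼 4) Q] [IsManifold (𝓡 4) ∞ Q]
    [ConnectedSpace Q] [SimplyConnectedSpace Q] (G : SurgeryGlueData (𝔼 4) 3 Q M') : IsNeckSurgeryResolvable Q :=
  isNeckSurgeryResolvable_of_surgeryGlueData_aux hC hM' _ Q G rfl

end Literature.Geometry.Riemannian

end
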